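import Mathlib.Analysis.Fourier.Inversion
import Literature.NumberTheory.LFunctions.WeilExplicitContinuous
import Literature.NumberTheory.LFunctions.WeilMellinInversion
import Literature.NumberTheory.LFunctions.WeilSemilocalCompactnessProofs
import Literature.NumberTheory.LFunctions.ZetaZeroReciprocalSum
import Literature.Analysis.SpecialFunctions.DigammaVerticalSeries
import HarnessLib

/-!
# The explicit formula for `Σ_ρ m(ρ) F(γ_ρ − t)` with `F` entire of exponential type (under RH)

Topic `Literature/NumberTheory/LFunctions`. Everything in this file is PROVED (no definitions, no
named facts).

This is Balazard–de Roton's Prop. 11 (*Notes de lecture…*, arXiv:0810.3587, §4.2: the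
Guinand–Weil formula for `h` analytic in `|Im s| ≤ ½ + ε` with `h(s) ≪ (1+|s|)^{−1−δ}`, real on
`ℝ`) in the form in which it is APPLIED in the proof of their Prop. 15 ("`f(u) = F₊(u − t)`
vérifie les hypothèses de la proposition 11 … car `f̂(x) = e^{−2iπtx} F̂₊(x)`"): for `F` entire
with `|F(z)| ≤ K e^{2πΔ|Im z|} ((1+(Re z − a)²)⁻¹ + (1+(Re z − b)²)⁻¹)` whose restriction to `ℝ`
has Fourier transform supported in `[−Δ, Δ]`, and `t ∈ ℝ`, under the Riemann hypothesis,

  `Σ_ρ m(ρ) F(γ − t) = F(i/2 − t) + F(−i/2 − t)`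
  `  − Σ_n Λ(n) n^{−½} (1/2π)(n^{−it} F̂(log n/2π) + n^{it} F̂(−log n/2π))`
  `  + (1/2π) ∫ F(u − t) Re ψ(¼ + iu/2) du − (1/2π) F̂(0) log π`

(`Literature.NumberTheory.LFunctions.tsum_zeros_shift_eq_explicit`; the sum over the
non-trivial zeros converges absolutely). It is obtained from the tree's explicit formula for
continuous compactly supported test functions
(`Literature.NumberTheory.LFunctions.explicit_formula_continuous`) applied to
`g(x) = (1/2π) f̂(x/2π)`, `f(u) = F(u − t)`, for which `ĝ(½ + iu) = f(u)` by Fourier inversion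
and `ĝ(0), ĝ(1) = F(±i/2 − t)` by the identity theorem.

## References

* [BalazardDeRoton2008] M. Balazard, A. de Roton, arXiv:0810.3587, Prop. 11 and the proof of
  Prop. 15. [cite: BalazardDeRoton2008, Prop. 11]
* [Bombieri2000Weil] E. Bombieri, Rend. Mat. Acc. Lincei (9) 11 (2000), Thm. 2.
-/

noncomputable section

open Complex Filter Set MeasureTheory Topology
open scoped Real FourierTransform

namespace Literature.NumberTheory.LFunctions

open Literature.Analysis.SpecialFunctions

namespace BandLimited

variable {F : ℂ → ℂ} {Δ K a b : ℝ}

/-- The profile `(1+(x−a)²)⁻¹ + (1+(x−b)²)⁻¹` is integrable. [folklore] -/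
lemma integrable_profile (a b : ℝ) :
    Integrable fun x : ℝ ↦ (1 + (x - a) ^ 2)⁻¹ + (1 + (x - b) ^ 2)⁻¹ :=
  (integrable_inv_one_add_sq.comp_sub_right a).add (integrable_inv_one_add_sq.comp_sub_right b)

/-- Comparison `(1 + (γ − c)²)⁻¹ ≤ 2(1 + c²)(1 + γ²)⁻¹`. [folklore] -/
lemma inv_one_add_sq_sub_le (γ c : ℝ) : (1 + (γ - c) ^ 2)⁻¹ ≤ 2 * (1 + c ^ 2) * (1 + γ ^ 2)⁻¹ := by
  rw [← div_eq_mul_inv, le_div_iff₀ (by positivity)]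
  rw [inv_mul_le_iff₀ (by positivity)]
  nlinarith [sq_nonneg (γ - 2 * c), sq_nonneg (γ - c), sq_nonneg c, sq_nonneg (c * (γ - c)),
    sq_nonneg (γ - c - c)]

/-- The shifted restriction `f(u) = F(u − t)` is continuous. [folklore] -/
lemma continuous_shift (hF : Differentiable ℂ F) (t : ℝ) : Continuous fun u : ℝ ↦ F ((u - t : ℝ) : ℂ) :=
  hF.continuous.comp (by fun_prop)

/-- `|f(u)| ≤ K ((1+(u−t−a)²)⁻¹ + (1+(u−t−b)²)⁻¹)`. [folklore] -/
lemma norm_shift_le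
    (hb : ∀ z : ℂ, ‖F z‖ ≤ K * Real.exp (2 * π * Δ * |z.im|) * ((1 + (z.re - a) ^ 2)⁻¹ + (1 + (z.re - b) ^ 2)⁻¹))
    (t u : ℝ) :
    ‖F ((u - t : ℝ) : ℂ)‖ ≤ K * ((1 + (u - t - a) ^ 2)⁻¹ + (1 + (u - t - b) ^ 2)⁻¹) := by
  have h := hb ((u - t : ℝ) : ℂ)
  simp only [Complex.ofReal_im, abs_zero, mul_zero, Real.exp_zero, mul_one, Complex.ofReal_re] at h
  exact h

/-- `f` is integrable. [folklore] -/
lemma integrable_shift (hF : Differentiable ℂ F)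
    (hb : ∀ z : ℂ, ‖F z‖ ≤ K * Real.exp (2 * π * Δ * |z.im|) * ((1 + (z.re - a) ^ 2)⁻¹ + (1 + (z.re - b) ^ 2)⁻¹))
    (t : ℝ) : Integrable fun u : ℝ ↦ F ((u - t : ℝ) : ℂ) := by
  refine Integrable.mono' (((integrable_profile a b).comp_sub_right t).const_mul K)
    (continuous_shift hF t).aestronglyMeasurable (Eventually.of_forall fun u ↦ ?_)
  have := norm_shift_le hb t u
  simpa [sub_sub] using this

/-- `f̂(ξ) = e^{−2πitξ} F̂(ξ)` (translation). [folklore] -/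
lemma fourier_shift (F : ℂ → ℂ) (t ξ : ℝ) :
    𝓕 (fun u : ℝ ↦ F ((u - t : ℝ) : ℂ)) ξ = Complex.exp (-(2 * π * t * ξ) * I) * 𝓕 (fun x : ℝ ↦ F x) ξ := by
  rw [Real.fourier_real_eq_integral_exp_smul, Real.fourier_real_eq_integral_exp_smul]
  have h := integral_add_right_eq_self (μ := volume)
    (fun v : ℝ ↦ Complex.exp (↑(-2 * π * v * ξ) * I) • F ((v - t : ℝ) : ℂ)) t
  rw [← h]
  simp only [add_sub_cancel_right, smul_eq_mul]
  rw [← MeasureTheory.integral_const_mul]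
  refine integral_congr_ae (Eventually.of_forall fun u ↦ ?_)
  beta_reduce
  rw [← mul_assoc, ← Complex.exp_add]
  congr 1
  push_cast
  ring

end BandLimited

open BandLimited in
/-- **The explicit formula for the zero sum `Σ_ρ m(ρ) F(γ_ρ − t)`** (Balazard–de Roton 2008,
Prop. 11 applied to `f = F(· − t)` as in the proof of their Prop. 15). Let `F` be entire with
`|F(z)| ≤ K e^{2πΔ|Im z|} ((1+(Re z − a)²)⁻¹ + (1+(Re z − b)²)⁻¹)`, with `𝓕(F|_ℝ)(ξ) = 0` for
`|ξ| ≥ Δ`, and let `t ∈ ℝ` be such that `u ↦ F(u − t) Re ψ(¼ + iu/2)` is integrable. Under RH,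
`Σ_ρ ‖m(ρ) F(γ − t)‖ < ∞` and
`Σ_ρ m(ρ) F(γ − t) = F(i/2 − t) + F(−i/2 − t) − Σ_n Λ(n)n^{−½}(1/2π)(n^{−it}F̂(log n/2π) + n^{it}F̂(−log n/2π))`
`+ (1/2π)∫ F(u − t) Re ψ(¼+iu/2) du − (1/2π) F̂(0) log π`. [cite: BalazardDeRoton2008, Prop. 11] -/
theorem tsum_zeros_shift_eq_explicit (hRH : RiemannHypothesis) {F : ℂ → ℂ} {Δ K a b : ℝ}
    (hΔ : 0 < Δ) (hF : Differentiable ℂ F) (hK : 0 ≤ K)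
    (hb : ∀ z : ℂ, ‖F z‖ ≤ K * Real.exp (2 * π * Δ * |z.im|) * ((1 + (z.re - a) ^ 2)⁻¹ + (1 + (z.re - b) ^ 2)⁻¹))
    (hsupp : ∀ ξ : ℝ, Δ ≤ |ξ| → 𝓕 (fun x : ℝ ↦ F x) ξ = 0) {t : ℝ}
    (hA : Integrable fun u : ℝ ↦ F ((u - t : ℝ) : ℂ) * (reDigammaQuarter u : ℂ)) :
    (Summable fun ρ : ZetaZeros.riemannZetaNontrivialZeros ↦
        ‖(riemannZetaZeroOrder (ρ : ℂ) : ℂ) * F (((ρ : ℂ).im - t : ℝ) : ℂ)‖) ∧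
    ∑' ρ : ZetaZeros.riemannZetaNontrivialZeros, (riemannZetaZeroOrder (ρ : ℂ) : ℂ) * F (((ρ : ℂ).im - t : ℝ) : ℂ) =
      F (I / 2 - t) + F (-(I / 2) - t)
      - ∑' n : ℕ, ((ArithmeticFunction.vonMangoldt n : ℝ) : ℂ) / (Real.sqrt n : ℂ) *
          ((1 / (2 * π) : ℂ) * (Complex.exp (-(t * Real.log n) * I) * 𝓕 (fun x : ℝ ↦ F x) (Real.log n / (2 * π))
            + Complex.exp ((t * Real.log n) * I) * 𝓕 (fun x : ℝ ↦ F x) (-(Real.log n / (2 * π)))))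
      + ((1 / (2 * π) : ℂ) * (∫ u : ℝ, F ((u - t : ℝ) : ℂ) * (reDigammaQuarter u : ℂ))
        - (1 / (2 * π) : ℂ) * 𝓕 (fun x : ℝ ↦ F x) 0 * (Real.log π : ℂ)) := by
  -- the shifted function and its transform
  set f : ℝ → ℂ := fun u ↦ F ((u - t : ℝ) : ℂ) with hfdef
  have hfc : Continuous f := continuous_shift hF t
  have hfi : Integrable f := integrable_shift hF hb t
  set Φ : ℝ → ℂ := 𝓕 f with hΦdef
  have hΦ : ∀ ξ : ℝ, Φ ξ = Complex.exp (-(2 * π * t * ξ) * I) * 𝓕 (fun x : ℝ ↦ F x) ξ :=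
    fun ξ ↦ fourier_shift F t ξ
  have hΦc : Continuous Φ :=
    VectorFourier.fourierIntegral_continuous Real.continuous_fourierChar continuous_inner hfi
  have hΦ0 : ∀ ξ : ℝ, Δ ≤ |ξ| → Φ ξ = 0 := fun ξ hξ ↦ by rw [hΦ ξ, hsupp ξ hξ, mul_zero]
  have hΦsupp : HasCompactSupport Φ := by
    refine HasCompactSupport.intro (isCompact_Icc (a := -Δ) (b := Δ)) fun ξ hξ ↦ hΦ0 ξ ?_
    rw [mem_Icc, not_and_or, not_le, not_le] at hξ
    rcases hξ with h | h
    · rw [abs_of_neg (by linarith)]; linarith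
    · rw [abs_of_pos (by linarith)]; linarith
  have hΦi : Integrable Φ := hΦc.integrable_of_hasCompactSupport hΦsupp
  -- the test function `g(x) = (1/2π) Φ(x/2π)`
  set g : ℝ → ℂ := fun x ↦ (1 / (2 * π) : ℂ) * Φ (x / (2 * π)) with hgdef
  have hgc : Continuous g := continuous_const.mul (hΦc.comp (continuous_id.div_const _))
  have hg0 : ∀ x : ℝ, 2 * π * Δ ≤ |x| → g x = 0 := by
    intro x hx
    have : Δ ≤ |x / (2 * π)| := by
      rw [abs_div, abs_of_pos (by positivity : (0 : ℝ) < 2 * π), le_div_iff₀ (by positivity)]; linarith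
    simp only [hgdef, hΦ0 _ this, mul_zero]
  have hgs : HasCompactSupport g := by
    refine HasCompactSupport.intro (isCompact_Icc (a := -(2 * π * Δ)) (b := 2 * π * Δ)) fun x hx ↦ hg0 x ?_
    rw [mem_Icc, not_and_or, not_le, not_le] at hx
    rcases hx with h | h
    · rw [abs_of_neg (by nlinarith [Real.pi_pos])]; linarith
    · rw [abs_of_pos (by nlinarith [Real.pi_pos])]; linarith
  -- `ĝ(½ + iu) = f(u)` by Fourier inversion
  have hline : ∀ u : ℝ, weilMellin g (1 / 2 + u * I) = f u := by
    intro u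
    rw [weilMellin_half_line_eq]
    have h1 : (fun x : ℝ ↦ g x * Complex.exp (u * I * x)) =
        fun x : ℝ ↦ (fun y : ℝ ↦ (1 / (2 * π) : ℂ) * (Complex.exp (↑(2 * π * (y * u)) * I) * Φ y)) (x / (2 * π)) := by
      funext x
      simp only [hgdef]
      have : Complex.exp (u * I * x) = Complex.exp (↑(2 * π * (x / (2 * π) * u)) * I) := by
        congr 1
        have hπ : (2 * π : ℝ) ≠ 0 := by positivity
        field_simp
        push_cast
        ring
      rw [this]; ring
    rw [h1, Measure.integral_comp_div (fun y : ℝ ↦ (1 / (2 * π) : ℂ) * (Complex.exp (↑(2 * π * (y * u)) * I) * Φ y)) (2 * π)]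
    rw [MeasureTheory.integral_const_mul, abs_of_pos (by positivity : (0 : ℝ) < 2 * π)]
    have hinv : 𝓕⁻ Φ u = ∫ y : ℝ, Complex.exp (↑(2 * π * (y * u)) * I) * Φ y := by
      rw [Real.fourierInv_eq']
      refine integral_congr_ae (Eventually.of_forall fun y ↦ ?_)
      simp [smul_eq_mul, mul_comm y u]
    have hFI : 𝓕⁻ Φ = f := by
      rw [hΦdef]; exact hfc.fourierInv_fourier_eq hfi hΦi
    rw [← hinv, hFI]
    simp only [real_smul]
    have hπ : ((2 * π : ℝ) : ℂ) ≠ 0 := by exact_mod_cast (by positivity : (2 * π : ℝ) ≠ 0)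
    field_simp
    push_cast
    ring
  -- zeros under RH
  have hzero : ∀ ρ : ZetaZeros.riemannZetaNontrivialZeros,
      weilMellin g (ρ : ℂ) = F (((ρ : ℂ).im - t : ℝ) : ℂ) := by
    intro ρ
    have hre : (ρ : ℂ).re = 1 / 2 := by
      refine hRH ρ (ZetaZeros.riemannZetaNontrivialZeros.zeta_eq_zero ρ.2) ?_
        (ZetaZeros.riemannZetaNontrivialZeros.ne_one ρ.2)
      rintro ⟨n, hn⟩
      have h0 := ZetaZeros.riemannZetaNontrivialZeros.re_pos ρ.2
      rw [hn] at h0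
      simp at h0
      linarith
    have heq : (ρ : ℂ) = 1 / 2 + ((ρ : ℂ).im : ℂ) * I := by
      apply Complex.ext <;> simp [hre]
    conv_lhs => rw [heq]
    rw [hline]
  -- summability of the zero side
  have hZ : Summable fun ρ : ZetaZeros.riemannZetaNontrivialZeros ↦
      ‖(riemannZetaZeroOrder (ρ : ℂ) : ℂ) * weilMellin g ρ‖ := by
    have hS := ZetaZeroSum.summable_zeroOrder_div_one_add_sq
    have hS' : Summable fun ρ : ZetaZeros.riemannZetaNontrivialZeros ↦
        (riemannZetaZeroOrder (ρ : ℂ) : ℝ) / (1 + (ρ : ℂ).im ^ 2) := hS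
    set C₁ : ℝ := K * (2 * (1 + (t + a) ^ 2) + 2 * (1 + (t + b) ^ 2)) with hC₁
    refine Summable.of_nonneg_of_le (fun _ ↦ norm_nonneg _) (fun ρ ↦ ?_) (hS'.mul_left C₁)
    have hm : (0 : ℝ) ≤ riemannZetaZeroOrder (ρ : ℂ) := by
      exact_mod_cast riemannZetaZeroOrder_nonneg (ZetaZeros.riemannZetaNontrivialZeros.ne_one ρ.2)
    rw [hzero ρ, norm_mul, Complex.norm_intCast, abs_of_nonneg hm]
    set γ := (ρ : ℂ).im with hγ
    have h1 := norm_shift_le hb t γ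
    have h2 : (1 + (γ - t - a) ^ 2)⁻¹ ≤ 2 * (1 + (t + a) ^ 2) * (1 + γ ^ 2)⁻¹ := by
      have := inv_one_add_sq_sub_le γ (t + a); rwa [show γ - (t + a) = γ - t - a by ring] at this
    have h3 : (1 + (γ - t - b) ^ 2)⁻¹ ≤ 2 * (1 + (t + b) ^ 2) * (1 + γ ^ 2)⁻¹ := by
      have := inv_one_add_sq_sub_le γ (t + b); rwa [show γ - (t + b) = γ - t - b by ring] at this
    calc (riemannZetaZeroOrder (ρ : ℂ) : ℝ) * ‖F ((γ - t : ℝ) : ℂ)‖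
        ≤ (riemannZetaZeroOrder (ρ : ℂ) : ℝ) * (K * ((1 + (γ - t - a) ^ 2)⁻¹ + (1 + (γ - t - b) ^ 2)⁻¹)) :=
          mul_le_mul_of_nonneg_left h1 hm
      _ ≤ (riemannZetaZeroOrder (ρ : ℂ) : ℝ) * (K * (2 * (1 + (t + a) ^ 2) * (1 + γ ^ 2)⁻¹ +
            2 * (1 + (t + b) ^ 2) * (1 + γ ^ 2)⁻¹)) := by gcongr
      _ = C₁ * ((riemannZetaZeroOrder (ρ : ℂ) : ℝ) / (1 + γ ^ 2)) := by rw [hC₁]; ring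
  -- the explicit formula for `g`
  have hA' : Integrable fun u : ℝ ↦ weilMellin g (1 / 2 + u * I) * ((Complex.digamma (1 / 4 + u / 2 * I)).re : ℂ) := by
    refine hA.congr (Eventually.of_forall fun u ↦ ?_)
    beta_reduce
    rw [hline u]; rfl
  have hEF := explicit_formula_continuous hgc hgs hZ hA'
  have hEF2 := hasWeilZeroSide_tsum hZ
  have hsum : ∑' ρ : ZetaZeros.riemannZetaNontrivialZeros, (riemannZetaZeroOrder (ρ : ℂ) : ℂ) * weilMellin g ρ =
      weilFunctional g := tendsto_nhds_unique hEF2 hEF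
  -- polar values by the identity theorem
  have hpolar : weilMellin g 0 = F (I / 2 - t) ∧ weilMellin g 1 = F (-(I / 2) - t) := by
    set Ψ : ℂ → ℂ := fun s ↦ F ((s - 1 / 2) * (-I) - t) with hΨ
    have hΨa : AnalyticOnNhd ℂ Ψ univ :=
      (hF.comp (((differentiable_id.sub_const _).mul_const _).sub_const _)).differentiableOn.analyticOnNhd
        isOpen_univ
    have hWa : AnalyticOnNhd ℂ (weilMellin g) univ := analyticOnNhd_weilMellin hgc hgs univ
    -- agreement on the critical line
    have hagree : ∀ u : ℝ, weilMellin g (1 / 2 + u * I) = Ψ (1 / 2 + u * I) := by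
      intro u
      rw [hline u, hΨ, hfdef]
      beta_reduce
      congr 1
      have hI : (1 / 2 + (u : ℂ) * I - 1 / 2) * -I - t = (u : ℂ) - t := by
        have : (u : ℂ) * I * -I = u := by rw [mul_assoc, mul_neg, Complex.I_mul_I]; ring
        linear_combination this
      rw [hI]
      push_cast
      ring
    have ht : Tendsto (fun k : ℕ ↦ (1 / 2 : ℂ) + ((1 / ((k : ℝ) + 1) : ℝ) : ℂ) * I) atTop
        (𝓝[≠] ((1 / 2 : ℂ))) := by
      refine tendsto_nhdsWithin_iff.2 ⟨?_, Eventually.of_forall fun k ↦ ?_⟩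
      · have h0 : Tendsto (fun k : ℕ ↦ (1 / 2 : ℂ) + ((1 / ((k : ℝ) + 1) : ℝ) : ℂ) * I) atTop
            (𝓝 ((1 / 2 : ℂ) + ((0 : ℝ) : ℂ) * I)) :=
          tendsto_const_nhds.add ((Complex.continuous_ofReal.tendsto _ |>.comp
            tendsto_one_div_add_atTop_nhds_zero_nat).mul tendsto_const_nhds)
        simpa using h0
      · rw [mem_compl_singleton_iff]
        intro h
        have him := congrArg Complex.im h
        have hr : ∀ r : ℝ, ((1 / 2 : ℂ) + (r : ℂ) * I).im = r := fun r ↦ by simp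
        have h1 : ((1 / 2 : ℂ) + ((1 / ((k : ℝ) + 1) : ℝ) : ℂ) * I).im = 1 / ((k : ℝ) + 1) := hr _
        have h2 : ((1 / 2 : ℂ)).im = 0 := by simp
        rw [h1, h2] at him
        have : (0 : ℝ) < 1 / ((k : ℝ) + 1) := by positivity
        linarith
    have hfreq : ∃ᶠ s in 𝓝[≠] ((1 / 2 : ℂ)), weilMellin g s = Ψ s :=
      ht.frequently (Eventually.of_forall fun k ↦ hagree _).frequently
    have hEq := hWa.eqOn_of_preconnected_of_frequently_eq hΨa isPreconnected_univ (mem_univ _) hfreq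
    constructor
    · have := hEq (mem_univ (0 : ℂ))
      rw [this, hΨ]
      ring_nf
    · have := hEq (mem_univ (1 : ℂ))
      rw [this, hΨ]
      ring_nf
  -- the prime term
  have hπC : (π : ℂ) ≠ 0 := Complex.ofReal_ne_zero.2 Real.pi_ne_zero
  have h_e1 : ∀ L : ℝ, Complex.exp (-(2 * π * t * ((L / (2 * π) : ℝ) : ℂ)) * I) = Complex.exp (-(t * L) * I) := by
    intro L
    congr 1
    have : (2 * π * t * ((L / (2 * π) : ℝ) : ℂ)) = t * L := by
      push_cast
      field_simp
    rw [this]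
  have h_e2 : ∀ L : ℝ, Complex.exp (-(2 * π * t * ((-(L / (2 * π)) : ℝ) : ℂ)) * I) = Complex.exp ((t * L) * I) := by
    intro L
    congr 1
    have : (2 * π * t * ((-(L / (2 * π)) : ℝ) : ℂ)) = -(t * L) := by
      push_cast
      field_simp
    rw [this, neg_neg]
  have hprime : weilPrimeTerm g = ∑' n : ℕ, ((ArithmeticFunction.vonMangoldt n : ℝ) : ℂ) / (Real.sqrt n : ℂ) *
      ((1 / (2 * π) : ℂ) * (Complex.exp (-(t * Real.log n) * I) * 𝓕 (fun x : ℝ ↦ F x) (Real.log n / (2 * π))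
        + Complex.exp ((t * Real.log n) * I) * 𝓕 (fun x : ℝ ↦ F x) (-(Real.log n / (2 * π))))) := by
    unfold weilPrimeTerm
    refine tsum_congr fun n ↦ ?_
    congr 1
    simp only [hgdef, neg_div]
    rw [hΦ, hΦ, h_e1, h_e2]
    ring
  -- assemble
  refine ⟨by simpa [hzero] using hZ, ?_⟩
  have hlhs : ∑' ρ : ZetaZeros.riemannZetaNontrivialZeros, (riemannZetaZeroOrder (ρ : ℂ) : ℂ) * F (((ρ : ℂ).im - t : ℝ) : ℂ) =
      ∑' ρ : ZetaZeros.riemannZetaNontrivialZeros, (riemannZetaZeroOrder (ρ : ℂ) : ℂ) * weilMellin g ρ :=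
    tsum_congr fun ρ ↦ by rw [hzero ρ]
  rw [hlhs, hsum]
  unfold weilFunctional weilPolarTerm weilArchTerm weilArchIntegral
  rw [hpolar.1, hpolar.2, hprime]
  have harch : (∫ u : ℝ, weilMellin g (1 / 2 + u * I) * ((Complex.digamma (1 / 4 + u / 2 * I)).re : ℂ)) =
      ∫ u : ℝ, F ((u - t : ℝ) : ℂ) * (reDigammaQuarter u : ℂ) :=
    integral_congr_ae (Eventually.of_forall fun u ↦ by beta_reduce; rw [hline u]; rfl)
  have hg0' : g 0 = (1 / (2 * π) : ℂ) * 𝓕 (fun x : ℝ ↦ F x) 0 := by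
    simp [hgdef, hΦ 0]
  rw [harch, hg0']

end Literature.NumberTheory.LFunctions
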